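import Literature.AnabelianGeometry.EtaleTheta.ArithThetaTowerBiratTriples
import Literature.AnabelianGeometry.EtaleTheta.ArithThetaTowerCdashFaithful
import Literature.AlgebraicGeometry.Frobenioids.PadicFrobenioidConstantMonoid
import HarnessLib

/-!
# [IUTchI] Ex. 3.2 (ii)/(v) at the ARITHMETIC theta tower over `𝒟_v̲ = CosetCat Π_v̲`: `𝒞^Θ_v → ℱ÷_v` is FAITHFUL and lies over
# `𝒟^Θ_v → 𝒟_v`, and the ASSEMBLED rest input `thetaRestBirat_of_carrierSpec` (GAP A item GA-16, file 2/2 = the D6 def of record)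

S. Mochizuki, *Inter-universal Teichmüller Theory I* [Mochizuki2012], Ex. 3.2 (ii) pp.70–71 («`ℱ÷_v := ℱ̲_v^birat`», «`Θ̲_v ∈
𝒪^×(T^÷_{Ÿ_v})`», «`l·ℤ ⊆ Aut(T_{Ÿ_v})`»), (iv) p.71 (`𝒞⊢_v`), (v) p.72 («`𝒪^▷_{𝒞^Θ_v}(−)` … determines a `p_v`-adic Frobenioid
`𝒞^Θ_v (⊆ ℱ÷_v)` — which may be thought of as a subcategory of `ℱ÷_v` … compatible with `q̲_v|_{T_A} ↦ Θ̲_v|_{T_{A^Θ}}`», the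
constants `𝒪^×_{K_v} → 𝒪^×(T^÷_{Ÿ_v})`) [claim: Mochizuki2012, status: disputed] (D-0012 claim key; a DEFINITION assembled over OUR
typed objects plus two proved laws; nothing of the series asserted); S. Mochizuki, *The geometry of Frobenioids I*
[MochizukiFrdI2008], Thm. 5.2 (ii) p.101 («the rational function monoid of `𝒞` is `B`», the tree's `temperedRatFnEquivBiratUnits`),
Prop. 4.4 pp.82–85; *Frobenioids II* [MochizukiFrdII2008] Ex. 1.1 (ii) p.8 (`B := B₀|_D ×_{Φ₀^gp} Φ^gp` of the `p_v`-adic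
Frobenioid); *The étale theta function …* [MochizukiEtTh2009] Def. 3.6 (ii) p.77.  GAP A of record G-L5-EX32I-1 (abc-iut cell),
item GA-16 = D6 «remaining laws + ASSEMBLY» of GAP-SIZING-A.md 69de97346848d3e8; ruled shape `plan/L5/GAP-A-SIGNATURES.md` v1
e3ccddf9b87597cf §5 D6, RULINGS #341 (B) (`(l : ℕ)` after `(hq)`), #345 (D) (signature countersigned), #348 (E).  Every decl is
stated over the BINDERS `(C : TemperedFrobenioid T' T.Dv VD) (hC : ArithThetaTower.CarrierSpec d T C) (hF : PreFrobenioid.IsFrobenioid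
C.toElem)` — never over the term `temperedFrobenioid d T` (GA-12) — and GA-07 instantiates.

WHAT IS HERE.
* §1 **`unitPart_injective`**: GA-06's unit map `B_{𝒞^Θ_v}(A^Θ) → B(Ÿ_T × A)^×`, `x ↦ const(x) · ρ^{n(x)}` (`q̲_v ↦ Θ̲_v|_{Ÿ_T × A}`,
  `ArithThetaTowerCThetaUnits.lean`) is INJECTIVE.  Proof: write `Div_B x = (i − j)·log q̲_v`; clear the denominator
  `ρ · const(q̲_v) = Θ̲|`; eliminate the common image; read birational divisors — the constants go through `divUnits` of `Ω^A`
  (`divB_constRatFn`, `PadicFrd.divUnits_map`), and the fibre-product condition of `B_{𝒞^Θ_v}` ([FrdII] Ex. 1.1 (ii)) says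
  `b_x · q̲^j` and `q̲^i` have the same divisor, so every constant contribution cancels and `Div(Θ̲|_{Ÿ_T × A})^{i+l} = Div(Θ̲|)^{k+j}`;
  **`Div Θ̲ = [Z] − [Pl] ≠ 0`** (file 1/2 `divB_thetaRatFn_ne_one`, from S0's `theta` clause) pulls back injectively and `Φ^gp` is
  torsion-free, so the exponents agree, then the constants agree (`constRatFn_injective`, GENUINE constants ★ p669815;
  `thetaFieldUnits_injective`), hence `x = y`.  THIS is where S0's `theta` clause is load-bearing: a Θ̲ with trivial divisor fails here.
* §2 **(h₃) `cThetaToBirat_faithful`**: an arrow of `𝒞^Θ_v` is `F(d) ≫ (1, f, n·log q̲, u)`; its image is the birational triple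
  `F(d)^÷ ≫ (u·Θ̲^n) ≫ (pull-back)^÷`, which determines `d`, `Ÿ_T × f` and the birational unit (file 1/2 `triple_cancel`), hence `f`
  (`dTheta_hom_ext`), `u` ([FrdI] Thm. 5.2 (ii) `B ≃* 𝒪^×(T^÷)` + §1) and the arrow (`cTheta_hom_ext`).
  **(h₄) `cThetaToBirat_comp_base` / `cThetaToBiratBaseIso` / `cThetaToBirat_base`**: `𝒞^Θ_v → ℱ÷_v → 𝒟_v` EQUALS
  `𝒞^Θ_v → 𝒟^Θ_v ⊆ (𝒟_v)_{Ÿ_v} → 𝒟_v` (objects on the nose; arrows by file 1/2 `biratOps_base_map_triple`).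
* §3 **`def thetaRestBirat_of_carrierSpec (hC) (hF) {qroot} (hq) (l : ℕ) : TemperedThetaRestBirat d T hq C hF`** := GA-06's
  `thetaRestBiratData hC hF hq l` (`theta hC hF`, `lZ hC l`, `constUnits hC hF`, `cThetaToBirat hC hF hq`) assembled by `toRestBirat`
  with GA-13's `cdashToC hC hq` / `cdashToC_faithful` / `cdashToC_base` (sub-gap (a), NON-VACUOUS over all of `𝒟⊢_v ⊆ 𝒟_v`) and
  (h₃), (h₄); read-outs (rfl) and **`Fbirat := PreFrobenioid.toBirat` BY NAME** (`thetaRestBirat_of_carrierSpec_toRest_birat`).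
  `hD : CarrierSpec.PullDichotomy C` is NOT a binder here (no slot field consumes the Cor. 3.8 (ii) bundle; RULINGS #345 (D)).
carrier: genuine-by-[EtTh]-recipe on the T-lattice (Ÿ_T, Ÿ_T × V, X̲̲_v̲ × V) + constants everywhere; off-lattice Φ via
`rebase`/pullback; [EtTh] Def 3.3 Φ at general U and print's Ÿ̈/μ_N Kummer levels = FOUNDATIONS 13/14, not claimed (#322
(c3′); this file defines no carrier, it reads the one `hC` specifies).  GUARD (#322): at a non-theta-type `T` the carrier is
print's recipe TRANSPORTED by (n_T, e(V|K_v̲)); the finite avatar of `l·ℤ` is LABELLED (FOUNDATIONS 13 U2), never `≅ ℤ`.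
HONEST FRAMING: an ASSEMBLY (one `def`) + proved laws over a `Prop`-valued spec at OUR typed objects; TYPED ≠ INHABITED (the
term is GA-12's / GA-07's) ≠ proved-in-print ≠ tokened; [EtTh] Prop. 5.1 / Thm. 5.7 enter only as the NAME of Θ̲'s class; an
UNDISPUTED construction around [IUTchIII] Cor. 3.12, which stays OPEN by charter (D-0045) — no side taken on it or on any author;
nothing here asserts the abc conjecture proved or refuted; count-neutral.  No instance, no notation, no `sorry`.
-/

noncomputable section

namespace Literature.AnabelianGeometry.EtaleTheta

namespace ArithThetaTower

open CategoryTheory Opposite Function Literature.AlgebraicGeometry.Frobenioids Literature.AnabelianGeometry.SemiGraphs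
  Literature.IUT.HodgeTheaters Literature.AlgebraicGeometry.Frobenioids.PadicFrd

/-! ## §1 The unit map `q̲_v ↦ Θ̲_v` is injective -/

section UnitPartInjective

variable {p : ℕ} [Fact p.Prime] {d : GaloisValDatum.{0} p} {P : Type} [Group P] [TopologicalSpace P]
  {T : BadLocalGroupDatum d.Gal P}
  {T' : RealifiedDivisorMonoids (D₀ := T.Dv) treeMonoidVocabWeak.{0}} {VD : FrdICatStub.{0, 0, 0} T.Dv}
  {C : TemperedFrobenioid T' T.Dv VD} {qroot : intNonzero d.k} (hq : ¬ IsUnit qroot)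

/-- Every element of `M^gp` is a fraction `a/b` of elements of `M`. [folklore] -/
private theorem gp_exists_frac' {M : Type} [CommMonoid M] (c : Algebra.GrothendieckGroup M) :
    ∃ a b : M, c * Algebra.GrothendieckGroup.of b = Algebra.GrothendieckGroup.of a := by
  induction c using Localization.induction_on with
  | H p => exact ⟨p.1, p.2, by rw [Localization.mk_eq_monoidOf_mk'_apply]; exact Submonoid.LocalizationMap.mk'_spec _ p.1 p.2⟩

/-- `(Ω^{A})^× → (Ω^{aug(Ÿ_T × A)})^×` is injective (it is induced by a ring homomorphism out of a field).
([IUTchI] Ex 3.2 (v) p.72) [claim: Mochizuki2012, status: disputed] -/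
theorem thetaFieldUnits_injective (X : T.DTheta) : Injective (thetaFieldUnits d T X) := fun a b h =>
  Units.ext ((thetaFieldHom d T X).injective (by simpa [thetaFieldUnits] using congrArg Units.val h))

/-- For a `p`-adic local field, `K^× → (ord(𝒪_K^⊳) ⊗ ℝ_{≥0})^gp` and `K^× → ord(𝒪_K^⊳)^gp` have the same fibres
(`ord(𝒪_K^⊳) → ord(𝒪_K^⊳) ⊗ ℝ_{≥0}` is injective for the monoprime `ord(𝒪_K^⊳) ≅ ℤ_{≥0}`, and both monoids are
cancellative). [cite: MochizukiFrdII2008, Ex 1.1 (i) p.7] -/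
theorem divUnits_eq_of_divZeroHom_eq {X : PadicFld.{0} p} (hX : X.IsPadicLocal) {a b : (X.K)ˣ}
    (h : PadicFrd.divZeroHom X.K a = PadicFrd.divZeroHom X.K b) : PadicFrd.divUnits X.K a = PadicFrd.divUnits X.K b := by
  haveI : IsCancelMul (PadicFrd.OrdInt X.K) :=
    isIntegral_iff_isCancelMul.mp hX.isMonoprime_ordInt.isDivisorial.isPreDivisorial.isIntegral
  haveI := PadicFrd.isCancelMul_realification (PadicFrd.OrdInt X.K)
  exact gpMap_injective _ (Realification.of_injective hX.isMonoprime_ordInt) h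

/-- Clearing a denominator: from `U·ρ^j = c·ρ^i` and `ρ·q = Θ` to `U·Θ^j·q^i = c·q^j·Θ^i`. [folklore] -/
private theorem grp_clear {G : Type} [CommGroup G] {U c ρ q Θ : G} (i j : ℕ) (hρq : ρ * q = Θ)
    (ux : U * ρ ^ j = c * ρ ^ i) : U * Θ ^ j * q ^ i = c * q ^ j * Θ ^ i := by
  subst hρq
  rw [mul_pow, mul_pow]
  calc U * (ρ ^ j * q ^ j) * q ^ i = U * ρ ^ j * (q ^ j * q ^ i) := by simp only [mul_assoc]
    _ = c * ρ ^ i * (q ^ j * q ^ i) := by rw [ux]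
    _ = c * q ^ j * (ρ ^ i * q ^ i) := by simp only [mul_assoc, mul_comm, mul_left_comm]

/-- Eliminating the common unknown `U` from two cleared equations. [folklore] -/
private theorem grp_elim {G : Type} [CommGroup G] {U cx cy q Θ : G} {i j k l : ℕ}
    (eqx : U * Θ ^ j * q ^ i = cx * q ^ j * Θ ^ i) (eqy : U * Θ ^ l * q ^ k = cy * q ^ l * Θ ^ k) :
    cx * q ^ j * q ^ k * Θ ^ (i + l) = cy * q ^ l * q ^ i * Θ ^ (k + j) := by
  rw [pow_add, pow_add]
  calc cx * q ^ j * q ^ k * (Θ ^ i * Θ ^ l) = cx * q ^ j * Θ ^ i * (Θ ^ l * q ^ k) := by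
        simp only [mul_assoc, mul_comm, mul_left_comm]
    _ = U * Θ ^ j * q ^ i * (Θ ^ l * q ^ k) := by rw [eqx]
    _ = U * Θ ^ l * q ^ k * (Θ ^ j * q ^ i) := by simp only [mul_assoc, mul_comm, mul_left_comm]
    _ = cy * q ^ l * Θ ^ k * (Θ ^ j * q ^ i) := by rw [eqy]
    _ = cy * q ^ l * q ^ i * (Θ ^ k * Θ ^ j) := by simp only [mul_assoc, mul_comm, mul_left_comm]

/-- Reading the eliminated equation modulo the constants: the exponents of `t` agree. [folklore] -/
private theorem grp_exp {G : Type} [CommGroup G] {cx cy q t : G} {i j k l : ℕ}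
    (h : cx * q ^ j * q ^ k * t ^ (i + l) = cy * q ^ l * q ^ i * t ^ (k + j)) (hx : cx * q ^ j = q ^ i)
    (hy : cy * q ^ l = q ^ k) : t ^ (i + l) = t ^ (k + j) := by
  rw [hx, show cy * q ^ l * q ^ i = q ^ k * q ^ i by rw [hy], mul_comm (q ^ k) (q ^ i)] at h
  exact mul_left_cancel h

/-- Reading the eliminated equation once the exponents agree: the constants agree. [folklore] -/
private theorem grp_cst {G : Type} [CommGroup G] {cx cy q t : G} {i j k l : ℕ}
    (h : cx * q ^ j * q ^ k * t ^ (i + l) = cy * q ^ l * q ^ i * t ^ (k + j)) (he : i + l = k + j) :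
    cx * q ^ (j + k) = cy * q ^ (l + i) := by
  rw [he] at h
  have h' := mul_right_cancel h
  rw [pow_add, pow_add, ← mul_assoc, ← mul_assoc]
  exact h'

/-- Cancelling a common factor: `γ·a = b`, `γ'·c = e`, `b·c = e·a` give `γ = γ'`. [folklore] -/
private theorem grp_div {G : Type} [CommGroup G] {γ γ' a b c e : G} (hx : γ * a = b) (hy : γ' * c = e)
    (hbc : b * c = e * a) : γ = γ' := by
  have h : γ * (a * c) = γ' * (a * c) := by
    rw [← mul_assoc, hx, hbc, ← hy, mul_assoc, mul_comm c a]
  exact mul_right_cancel h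

/-- **The unit map `B_{𝒞^Θ_v}(A^Θ) → B(Ÿ_T × A)^×`, `x ↦ const(x) · ρ^{n(x)}`, is injective.**  If two elements have
the same image, comparing birational divisors kills the constants of valuation zero and leaves `m · Div(Θ̲|_{Ÿ_T × A}) = 0`
for the difference `m` of the exponents; `Div Θ̲ = [Z] − [Pl] ≠ 0` (genuine theta divisor, `divB_thetaRatFn_ne_one`) pulls
back injectively and `Φ^gp` is torsion-free, so `m = 0`; then the constants agree, and `constRatFn` (genuine constants,
★ p669815) and `Ω^A → Ω^{aug(Ÿ_T × A)}` are injective.  This is where S0's `theta` clause is load-bearing for the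
faithfulness of `𝒞^Θ_v → ℱ÷_v`. ([IUTchI] Ex 3.2 (v) p.72) [claim: Mochizuki2012, status: disputed] -/
theorem unitPart_injective (hC : CarrierSpec d T C) (hF : PreFrobenioid.IsFrobenioid C.toElem) (X : T.DTheta) :
    Injective (unitPart d T hq hC X) := by
  intro x y hxy
  -- the exponents of `Div_B x`, `Div_B y` in `(ℕ·log q̲)^gp`
  obtain ⟨ax, bx', hx⟩ := gp_exists_frac' (((T.thetaDatum d hq).divB.app (op X)).hom x)
  obtain ⟨i, rfl⟩ := exists_eq_logqAt_pow hq X ax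
  obtain ⟨j, rfl⟩ := exists_eq_logqAt_pow hq X bx'
  obtain ⟨ay, by', hy⟩ := gp_exists_frac' (((T.thetaDatum d hq).divB.app (op X)).hom y)
  obtain ⟨k, rfl⟩ := exists_eq_logqAt_pow hq X ay
  obtain ⟨l, rfl⟩ := exists_eq_logqAt_pow hq X by'
  obtain ⟨bx, hbx⟩ : ∃ b : (((T.thetaBase d).obj X).K)ˣ, ((T.thetaDatum d hq).toB0.app (op X)).hom x = b := ⟨_, rfl⟩
  obtain ⟨by_, hby⟩ : ∃ b : (((T.thetaBase d).obj X).K)ˣ, ((T.thetaDatum d hq).toB0.app (op X)).hom y = b := ⟨_, rfl⟩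
  -- the constants read through `Ω^A → Ω^{aug(Ÿ_T × A)}`, the generator `q̲`, the unit `Θ̲|`, the divisor read-outs
  let Kc : (((T.thetaBase d).obj X).K)ˣ →* (C.ratFnFunctor.obj (op (dThetaObj T X)) : Type)ˣ :=
    (constRatFn hC (dThetaObj T X)).toHomUnits.comp (thetaFieldUnits d T X)
  let qXu : (((T.thetaBase d).obj X).K)ˣ :=
    PadicFrd.intNonzeroToUnits _ ((d.relEmb.restrict T.prodEquiv.inverse).img qroot X)
  let Θu : (C.ratFnFunctor.obj (op (dThetaObj T X)) : Type)ˣ :=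
    (isUnit_ratFn C (dThetaObj T X) (thetaRatFnAt hC X)).unit
  let DB : (C.ratFnFunctor.obj (op (dThetaObj T X)) : Type)ˣ →* Algebra.GrothendieckGroup (C.Φ.carrier (op (dThetaObj T X))) :=
    (C.divB (op (dThetaObj T X))).comp (Units.coeHom _)
  let δK : (((T.thetaBase d).obj X).K)ˣ →* Algebra.GrothendieckGroup (C.Φ.carrier (op (dThetaObj T X))) :=
    (gpMap (hC.ofLattice (dThetaObj T X))).comp ((gpMap (hC.constDivIncl (op (dThetaObj T X)))).comp
      ((PadicFrd.gpMapOfHom (thetaFieldHom d T X) (d.fieldFunctor.map (projDTheta T X)).isValHom).comp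
        (PadicFrd.divUnits _)))
  -- `ρ · const(q̲) = Θ̲|`
  have hρq : rhoAt hC qroot X * Kc qXu = Θu := inv_mul_cancel_right _ _
  -- `unitPart x · ρ^j = const(b_x) · ρ^i`
  have ux : unitPart d T hq hC X x * rhoAt hC qroot X ^ j = Kc bx * rhoAt hC qroot X ^ i := by
    have e := congrArg (rhoPowGp d T hq hC X) hx
    rw [map_mul, rhoPowGp_of_pow, rhoPowGp_of_pow] at e
    rw [unitPart_apply, hbx, mul_assoc, e]
    rfl
  have uy : unitPart d T hq hC X y * rhoAt hC qroot X ^ l = Kc by_ * rhoAt hC qroot X ^ k := by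
    have e := congrArg (rhoPowGp d T hq hC X) hy
    rw [map_mul, rhoPowGp_of_pow, rhoPowGp_of_pow] at e
    rw [unitPart_apply, hby, mul_assoc, e]
    rfl
  -- clear the denominators `const(q̲)` and eliminate `unitPart x = unitPart y`
  have eqx := grp_clear i j hρq ux
  have eqy := grp_clear k l hρq uy
  rw [hxy] at eqx
  have key := grp_elim eqx eqy
  -- the divisor of a constant factors through `divUnits` of `Ω^A`
  have hDBK : ∀ v, DB (Kc v) = δK v := fun v => by
    change (C.divBNatTrans.app (op (dThetaObj T X))).hom (constRatFn hC (dThetaObj T X) (thetaFieldUnits d T X v)) = _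
    rw [divB_constRatFn]
    change gpMap (hC.ofLattice (dThetaObj T X)) (gpMap (hC.constDivIncl (op (dThetaObj T X))) (PadicFrd.divUnits _
      (Units.map (thetaFieldHom d T X : ((T.thetaBase d).obj X).K →* (d.fieldFunctor.obj (T.proj.obj (dThetaObj T X))).K)
        v))) = _
    rw [PadicFrd.divUnits_map (thetaFieldHom d T X) (d.fieldFunctor.map (projDTheta T X)).isValHom v]
    rfl
  -- the constants are read injectively
  have hKinj : Function.Injective Kc := fun a b h =>
    thetaFieldUnits_injective X (constRatFn_injective hC (dThetaObj T X) (congrArg Units.val h))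
  -- `Div(Θ̲|_{Ÿ_T × A})` is a non-torsion element
  have ht : DB Θu ≠ 1 := by
    intro h
    apply divB_thetaRatFn_ne_one hC hF
    apply gpMap_pull_injective hF (T.dThetaIncl.obj X).hom.op
    refine Eq.trans ?_ (map_one _).symm
    exact h
  -- the fibre-product condition of `B_{𝒞^Θ}`: `ord(b_x) = (i − j)·ord q̲`
  have hgen : PadicFrd.divZeroHom _ qXu = Algebra.GrothendieckGroup.of
      (PadicFrd.Monogenic.gen (T.thetaBase d) ((d.relEmb.restrict T.prodEquiv.inverse).img qroot) X) :=
    PadicFrd.divZeroHom_intNonzeroToUnits _ _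
  have hιL : ∀ n : ℕ, MonGp.map ((T.thetaDatum d hq).ι.app (op X)).hom (Algebra.GrothendieckGroup.of (logqAt d T hq X ^ n)) =
      PadicFrd.divZeroHom _ qXu ^ n := fun n => by
    rw [MonGp.map_of, hgen, ← map_pow]
    rfl
  have memB : ∀ z : (T.thetaDatum d hq).B.obj (op X),
      PadicFrd.divZeroHom ((T.thetaBase d).obj X).K (((T.thetaDatum d hq).toB0.app (op X)).hom z) =
        MonGp.map ((T.thetaDatum d hq).ι.app (op X)).hom (((T.thetaDatum d hq).divB.app (op X)).hom z) := fun z => by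
    have mem := (PadicFrd.Monogenic.mem_BSub_iff _ _ _ _).mp z.2
    exact mem
  -- from here on the definitions of `Kc`, `q̲`, `Θ̲|` are no longer unfolded
  clear_value Kc qXu Θu
  have mx : PadicFrd.divZeroHom _ bx = MonGp.map ((T.thetaDatum d hq).ι.app (op X)).hom
      (((T.thetaDatum d hq).divB.app (op X)).hom x) := by
    rw [← hbx]; exact memB x
  have my : PadicFrd.divZeroHom _ by_ = MonGp.map ((T.thetaDatum d hq).ι.app (op X)).hom
      (((T.thetaDatum d hq).divB.app (op X)).hom y) := by
    rw [← hby]; exact memB y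
  have fibx : PadicFrd.divZeroHom _ (bx * qXu ^ j) = PadicFrd.divZeroHom _ (qXu ^ i) :=
    (map_mul (PadicFrd.divZeroHom _) bx (qXu ^ j)).trans <|
      (congrArg₂ (· * ·) mx (map_pow (PadicFrd.divZeroHom _) qXu j)).trans <|
        (congrArg (_ * ·) (hιL j).symm).trans <|
          (map_mul (MonGp.map ((T.thetaDatum d hq).ι.app (op X)).hom) _ _).symm.trans <|
            (congrArg (MonGp.map ((T.thetaDatum d hq).ι.app (op X)).hom) hx).trans <|
              (hιL i).trans (map_pow (PadicFrd.divZeroHom _) qXu i).symm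
  have fiby : PadicFrd.divZeroHom _ (by_ * qXu ^ l) = PadicFrd.divZeroHom _ (qXu ^ k) :=
    (map_mul (PadicFrd.divZeroHom _) by_ (qXu ^ l)).trans <|
      (congrArg₂ (· * ·) my (map_pow (PadicFrd.divZeroHom _) qXu l)).trans <|
        (congrArg (_ * ·) (hιL l).symm).trans <|
          (map_mul (MonGp.map ((T.thetaDatum d hq).ι.app (op X)).hom) _ _).symm.trans <|
            (congrArg (MonGp.map ((T.thetaDatum d hq).ι.app (op X)).hom) hy).trans <|
              (hιL k).trans (map_pow (PadicFrd.divZeroHom _) qXu k).symm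
  have δx0 : δK (bx * qXu ^ j) = δK (qXu ^ i) :=
    congrArg (fun t => gpMap (hC.ofLattice (dThetaObj T X)) (gpMap (hC.constDivIncl (op (dThetaObj T X)))
      (PadicFrd.gpMapOfHom (thetaFieldHom d T X) (d.fieldFunctor.map (projDTheta T X)).isValHom t)))
      (divUnits_eq_of_divZeroHom_eq (T.thetaBase_isPadicLocal d X) fibx)
  have δy0 : δK (by_ * qXu ^ l) = δK (qXu ^ k) :=
    congrArg (fun t => gpMap (hC.ofLattice (dThetaObj T X)) (gpMap (hC.constDivIncl (op (dThetaObj T X)))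
      (PadicFrd.gpMapOfHom (thetaFieldHom d T X) (d.fieldFunctor.map (projDTheta T X)).isValHom t)))
      (divUnits_eq_of_divZeroHom_eq (T.thetaBase_isPadicLocal d X) fiby)
  clear_value DB δK
  have δx : δK bx * δK qXu ^ j = δK qXu ^ i := by
    simp only [map_mul, map_pow] at δx0
    exact δx0
  have δy : δK by_ * δK qXu ^ l = δK qXu ^ k := by
    simp only [map_mul, map_pow] at δy0
    exact δy0
  -- compare divisors in `key`: the exponents agree
  have hexp : i + l = k + j := by
    have e := congrArg DB key
    simp only [map_mul, map_pow, hDBK] at e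
    have e' := grp_exp e δx δy
    by_contra hne
    have hinj : Function.Injective (fun n : ℕ => DB Θu ^ n) :=
      injective_pow_iff_not_isOfFinOrder.mpr fun hfin => by
        obtain ⟨n, hn, hn1⟩ := isOfFinOrder_iff_pow_eq_one.mp hfin
        exact ht (gp_eq_one_of_pow_eq_one hF (op (dThetaObj T X)) hn hn1)
    exact hne (hinj e')
  -- hence the constants agree, and so do `b_x`, `b_y` and the divisor components
  have hb : bx * qXu ^ (j + k) = by_ * qXu ^ (l + i) := by
    apply hKinj
    simp only [map_mul, map_pow]
    exact grp_cst key hexp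
  have hb' : bx = by_ := by
    rw [show j + k = l + i by omega] at hb
    exact mul_right_cancel hb
  have hbc : Algebra.GrothendieckGroup.of (logqAt d T hq X ^ i) * Algebra.GrothendieckGroup.of (logqAt d T hq X ^ l) =
      Algebra.GrothendieckGroup.of (logqAt d T hq X ^ k) * Algebra.GrothendieckGroup.of (logqAt d T hq X ^ j) := by
    have h : Algebra.GrothendieckGroup.of (logqAt d T hq X ^ (i + l)) = Algebra.GrothendieckGroup.of (logqAt d T hq X ^ (k + j)) := by
      rw [hexp]
    simp only [pow_add, map_mul] at h
    exact h
  have hγ : @Eq (Algebra.GrothendieckGroup ((T.thetaDatum d hq).Φ.obj (op X)))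
      (((T.thetaDatum d hq).divB.app (op X)).hom x) (((T.thetaDatum d hq).divB.app (op X)).hom y) := grp_div hx hy hbc
  exact Subtype.ext (Prod.ext (hbx.trans (hb'.trans hby.symm)) hγ)

end UnitPartInjective

/-! ## §2 (h₃) faithfulness and (h₄) base compatibility of `𝒞^Θ_v → ℱ÷_v`; §3 the assembled rest input -/

section Assembly

variable {p : ℕ} [Fact p.Prime] {d : GaloisValDatum.{0} p} {P : Type} [Group P] [TopologicalSpace P]
  {T : BadLocalGroupDatum d.Gal P}
  {T' : RealifiedDivisorMonoids (D₀ := T.Dv) treeMonoidVocabWeak.{0}} {VD : FrdICatStub.{0, 0, 0} T.Dv}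
  {C : TemperedFrobenioid T' T.Dv VD}

/-- **(h₃) `𝒞^Θ_v → ℱ÷_v` is FAITHFUL** («`𝒞^Θ_v ⊆ ℱ÷_v`, which may be thought of as a subcategory of `ℱ÷_v`», Ex. 3.2 (v)
p.72): two arrows of `𝒞^Θ_v` with the same birational triple `F(d)^÷ ≫ (u·Θ̲^n) ≫ (pull-back)^÷` have the same Frobenius degree
and the same base (`triple_cancel`: `F(d)^÷` epi in `C^birat`, units determined along pull-back morphisms), the same unit
(`unitPart_injective` — the genuine theta divisor at work — after [FrdI] Thm. 5.2 (ii) `B ≃* 𝒪^×(T^÷)`), hence coincide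
(`cTheta_hom_ext`). ([IUTchI] Ex 3.2 (v) p.72) [claim: Mochizuki2012, status: disputed] -/
theorem cThetaToBirat_faithful (hC : CarrierSpec d T C) (hF : PreFrobenioid.IsFrobenioid C.toElem) {qroot : intNonzero d.k}
    (hq : ¬ IsUnit qroot) : (cThetaToBirat hC hF hq).Faithful := by
  refine ⟨fun {X Y} φ ψ h => ?_⟩
  rw [cThetaToBirat_map, cThetaToBirat_map] at h
  obtain ⟨hd, hf, hu⟩ := triple_cancel C hF (d := ModelFrobenioid.degFr φ) (d' := ModelFrobenioid.degFr ψ)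
    (f := dThetaHom T (ModelFrobenioid.baseMap φ)) (f' := dThetaHom T (ModelFrobenioid.baseMap ψ))
    (u := BadLocalFrobenioid.temperedRatFnEquivBiratUnits C hF (dThetaObj T X.base)
      (unitPart d T hq hC X.base (ModelFrobenioid.unit φ) : C.ratFnFunctor.obj (op (dThetaObj T X.base))))
    (u' := BadLocalFrobenioid.temperedRatFnEquivBiratUnits C hF (dThetaObj T X.base)
      (unitPart d T hq hC X.base (ModelFrobenioid.unit ψ) : C.ratFnFunctor.obj (op (dThetaObj T X.base)))) h
  exact cTheta_hom_ext d T hq hd (dTheta_hom_ext d T hf)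
    (unitPart_injective hq hC hF X.base (Units.ext ((BadLocalFrobenioid.temperedRatFnEquivBiratUnits C hF _).injective hu)))

/-- **(h₄) `𝒞^Θ_v → ℱ÷_v` lies over `𝒟^Θ_v ⊆ (𝒟_v)_{Ÿ_v} → 𝒟_v` ON THE NOSE**: on objects `Base(T^÷_{Ÿ_T × A}) = Ÿ_T × A`
(the tempered Frobenioid is a model Frobenioid over `𝒟_v` itself), on arrows `Base(F(d)^÷ ≫ u ≫ (pull-back over Ÿ_T × f)^÷) =
Ÿ_T × f` (`biratOps_base_map_triple`). ([IUTchI] Ex 3.2 (v) p.72) [claim: Mochizuki2012, status: disputed] -/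
theorem cThetaToBirat_comp_base (hC : CarrierSpec d T C) (hF : PreFrobenioid.IsFrobenioid C.toElem)
    {qroot : intNonzero d.k} (hq : ¬ IsUnit qroot) :
    cThetaToBirat hC hF hq ⋙ (PreFrobenioid.biratOps hF (PreFrobenioid.hasBiratSquares_of_isFrobenioid hF)).base =
      T.CThetaBase d hq ⋙ T.dThetaIncl ⋙ Over.forget T.ydd :=
  CategoryTheory.Functor.hext (fun _ => rfl) fun X _ φ =>
    heq_of_eq (biratOps_base_map_triple C hF (ModelFrobenioid.degFr φ)
      (BadLocalFrobenioid.temperedRatFnEquivBiratUnits C hF (dThetaObj T X.base)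
        (unitPart d T hq hC X.base (ModelFrobenioid.unit φ) : C.ratFnFunctor.obj (op (dThetaObj T X.base))))
      (dThetaHom T (ModelFrobenioid.baseMap φ)))

/-- **(h₄) as a natural isomorphism** `𝒞^Θ_v → ℱ÷_v → 𝒟_v ≅ 𝒞^Θ_v → 𝒟^Θ_v ⊆ (𝒟_v)_{Ÿ_v} → 𝒟_v` (an `eqToIso`: the two
composites are EQUAL functors). ([IUTchI] Ex 3.2 (v) p.72) [claim: Mochizuki2012, status: disputed] -/
def cThetaToBiratBaseIso (hC : CarrierSpec d T C) (hF : PreFrobenioid.IsFrobenioid C.toElem) {qroot : intNonzero d.k}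
    (hq : ¬ IsUnit qroot) :
    cThetaToBirat hC hF hq ⋙ (PreFrobenioid.biratOps hF (PreFrobenioid.hasBiratSquares_of_isFrobenioid hF)).base ≅
      T.CThetaBase d hq ⋙ T.dThetaIncl ⋙ Over.forget T.ydd :=
  eqToIso (cThetaToBirat_comp_base hC hF hq)

/-- (h₄) as the slot's field type `CThetaToBirat_base` verbatim. ([IUTchI] Ex 3.2 (v) p.72) [claim: Mochizuki2012, status: disputed] -/
theorem cThetaToBirat_base (hC : CarrierSpec d T C) (hF : PreFrobenioid.IsFrobenioid C.toElem) {qroot : intNonzero d.k}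
    (hq : ¬ IsUnit qroot) :
    Nonempty (cThetaToBirat hC hF hq ⋙ (PreFrobenioid.biratOps hF (PreFrobenioid.hasBiratSquares_of_isFrobenioid hF)).base ≅
      T.CThetaBase d hq ⋙ T.dThetaIncl ⋙ Over.forget T.ydd) :=
  ⟨cThetaToBiratBaseIso hC hF hq⟩

/-- **[IUTchI] Ex. 3.2 (ii)/(v), THE ASSEMBLED REST INPUT over the decoupling spec** (GAP-A-SIGNATURES v1 §5 D6 + RULINGS
#341 (B): `(l : ℕ)` after `(hq)`): `TemperedThetaRestBirat d T hq C hF` with `Θ̲_v := theta hC hF` (the Θ̈-fraction under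
[FrdI] Thm. 5.2 (ii) `B(Ÿ_T) ≃* 𝒪^×(T^÷_{Ÿ_T})`), `l·ℤ := lZ hC l` («l·Aut_{𝒟_v}(Ÿ_T)»: the FINITE/LABELLED avatar, FOUNDATIONS 13
U2 — print's `l·ℤ` exactly when `Aut_{𝒟_v}(Ÿ_T) ≅ ℤ`), the GENUINE constants `𝒪^×_{K_v̲} → 𝒪^×(T^÷_{Ÿ_v})` (`constUnits hC hF`, via
`T.proj`), `𝒞⊢_v → 𝒞_v` := GA-13's `cdashToC hC hq` (faithful, over `𝒟⊢_v ⊆ 𝒟_v`), `𝒞^Θ_v → ℱ÷_v` := GA-06's `cThetaToBirat hC hF hq`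
(faithful: `cThetaToBirat_faithful`; over `𝒟^Θ_v → 𝒟_v`: `cThetaToBirat_base`).  `ℱ÷_v := ℱ̲_v^birat`, `ℱ̲_v → ℱ÷_v := PreFrobenioid.toBirat`
and `𝒪^×(T^÷_{Ÿ_v}) := (BiratUnits.toAut _).range` are then FORCED by `TemperedThetaRestBirat.toRest`; the `μ_{2l}` carve is
`BadLocalFrobenioid.mu2l`.  carrier: genuine-by-[EtTh]-recipe on the T-lattice (Ÿ_T, Ÿ_T × V, X̲̲_v̲ × V) + constants everywhere;
off-lattice Φ via `rebase`/pullback; [EtTh] Def 3.3 Φ at general U and print's Ÿ̈/μ_N Kummer levels = FOUNDATIONS 13/14, not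
claimed (#322 (c3′); this def reads the carrier `hC` specifies, it defines none).  [EtTh] Prop. 5.1 / Thm. 5.7 enter only as
the NAME of Θ̲'s class.  TYPED over the BINDERS `(C) (hC) (hF)`; the term is GA-12's / GA-07's; typed ≠ inhabited ≠ proved-in-print.
([IUTchI] Ex 3.2 (ii) p.70) [claim: Mochizuki2012, status: disputed] -/
def thetaRestBirat_of_carrierSpec (hC : CarrierSpec d T C) (hF : PreFrobenioid.IsFrobenioid C.toElem)
    {qroot : intNonzero d.k} (hq : ¬ IsUnit qroot) (l : ℕ) : TemperedThetaRestBirat d T hq C hF :=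
  (thetaRestBiratData hC hF hq l).toRestBirat (cdashToC hC hq) (cdashToC_faithful hC hq) (cdashToC_base hC hq)
    (cThetaToBirat_faithful hC hF hq) (cThetaToBirat_base hC hF hq)

/-- `Θ̲_v` of the assembled input IS `theta hC hF`. ([IUTchI] Ex 3.2 (ii) p.70) [claim: Mochizuki2012, status: disputed] -/
theorem thetaRestBirat_of_carrierSpec_theta (hC : CarrierSpec d T C) (hF : PreFrobenioid.IsFrobenioid C.toElem)
    {qroot : intNonzero d.k} (hq : ¬ IsUnit qroot) (l : ℕ) :
    (thetaRestBirat_of_carrierSpec hC hF hq l).theta = theta hC hF := rfl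

/-- `l·ℤ` of the assembled input IS `lZ hC l`. ([IUTchI] Ex 3.2 (ii) p.71) [claim: Mochizuki2012, status: disputed] -/
theorem thetaRestBirat_of_carrierSpec_lZ (hC : CarrierSpec d T C) (hF : PreFrobenioid.IsFrobenioid C.toElem)
    {qroot : intNonzero d.k} (hq : ¬ IsUnit qroot) (l : ℕ) :
    (thetaRestBirat_of_carrierSpec hC hF hq l).lZ = lZ hC l := rfl

/-- The constants of the assembled input ARE `constUnits hC hF` (GENUINE `𝒪^×_{K_v̲}` via `T.proj`).
([IUTchI] Ex 3.2 (v) p.72) [claim: Mochizuki2012, status: disputed] -/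
theorem thetaRestBirat_of_carrierSpec_constUnits (hC : CarrierSpec d T C) (hF : PreFrobenioid.IsFrobenioid C.toElem)
    {qroot : intNonzero d.k} (hq : ¬ IsUnit qroot) (l : ℕ) :
    (thetaRestBirat_of_carrierSpec hC hF hq l).constUnits = constUnits hC hF := rfl

/-- `𝒞^Θ_v → ℱ÷_v` of the assembled input IS GA-06's `cThetaToBirat hC hF hq` (the Θ̲-reading «`q̲_v|_{T_A} ↦ Θ̲_v|_{T_{A^Θ}}`»).
([IUTchI] Ex 3.2 (v) p.72) [claim: Mochizuki2012, status: disputed] -/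
theorem thetaRestBirat_of_carrierSpec_CThetaToBirat (hC : CarrierSpec d T C) (hF : PreFrobenioid.IsFrobenioid C.toElem)
    {qroot : intNonzero d.k} (hq : ¬ IsUnit qroot) (l : ℕ) :
    (thetaRestBirat_of_carrierSpec hC hF hq l).CThetaToBirat = cThetaToBirat hC hF hq := rfl

/-- `𝒞⊢_v → 𝒞_v` of the assembled input IS GA-13's `cdashToC hC hq`. ([IUTchI] Ex 3.2 (iv) p.71) [claim: Mochizuki2012, status: disputed] -/
theorem thetaRestBirat_of_carrierSpec_CdashToC (hC : CarrierSpec d T C) (hF : PreFrobenioid.IsFrobenioid C.toElem)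
    {qroot : intNonzero d.k} (hq : ¬ IsUnit qroot) (l : ℕ) :
    (thetaRestBirat_of_carrierSpec hC hF hq l).CdashToC = cdashToC hC hq := rfl

/-- **`Fbirat := PreFrobenioid.toBirat` BY NAME**: `ℱ̲_v → ℱ÷_v` of the rest input determined by the assembled data IS [FrdI] Prop. 4.4 (i)'s
natural functor into THE birationalization (`TemperedThetaRestBirat.toRest_birat`). ([IUTchI] Ex 3.2 (ii) p.70) [claim: Mochizuki2012, status: disputed] -/
theorem thetaRestBirat_of_carrierSpec_toRest_birat (hC : CarrierSpec d T C) (hF : PreFrobenioid.IsFrobenioid C.toElem)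
    {qroot : intNonzero d.k} (hq : ¬ IsUnit qroot) (l : ℕ) :
    (thetaRestBirat_of_carrierSpec hC hF hq l).toRest.birat =
      PreFrobenioid.toBirat C.toElem hF (PreFrobenioid.hasBiratSquares_of_isFrobenioid hF) := rfl

end Assembly

end ArithThetaTower

end Literature.AnabelianGeometry.EtaleTheta

end
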